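import Mathlib
import Summits.ResolutionOfSingularities.ResolutionOfSingularities.Theorems.WildQuotientsWildQuotientResolutionJordanFiveMu2CoverDescent
import Summits.ResolutionOfSingularities.ResolutionOfSingularities.Theorems.WildQuotientsWildQuotientResolutionFixedPointsGraded

/-!
# RUNG V5 (`J₅`), brick B7/HP₂ — the even subring of the cover: `U^{τ} = k[even generators, 1/ι]`

Sub-problem `ResolutionOfSingularities`, crux `WildQuotients.WildQuotientResolution`
(stmt-ResolutionOfSingularities-15640), line L1 W4.5c, brick `HP₂` (res-L1-w45c-plan-1 RULING
14:04:47Z (1): «036 = … + the generators lemma»). [OURS · L1 W4.5c]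

For a localisation `U` of `k[s, Y, pass] ⧸ I` away from `ι` and ANY `k`-automorphism `τ_U` with the
deck laws `s, Y₁, Y₃ ↦ −s, −Y₁, −Y₃` (`Y₁ = X (some b)`, `Y₃ = X (some d)`), the other variables and
`ι` fixed, and `2 ≠ 0` in `k`:

  **`U^{⟨τ_U⟩} = Algebra.adjoin k (π '' {s², sY₁, sY₃, Y₁², Y₁Y₃, Y₃²} ∪ π '' {X (some i) : i ∉ {b,d}}
    ∪ {1/ι})`**

(`fixedPoints_coverTau_eq_adjoin`): the range target of the chart identification
`B_{W₂} ≅ U₂^{τ}` (plan-1 (W₂-A)).  Proof: every `u ∈ U` is `e₀ + e₁ s + e₂ Y₁ + e₃ Y₃` with `eᵢ` in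
the even subring (`exists_even_decomposition`), and `τ_U` flips the sign of the last three terms.
-/

-- single-problem summit: the doubled namespace component `ResolutionOfSingularities` is forced
set_option linter.dupNamespace false

noncomputable section

open MvPolynomial
open Summit.ResolutionOfSingularities.ResolutionOfSingularities.Theorems.WildQuotientResolution.TameTransfer
  (mem_fixedPoints_zpowers_iff_apply_eq)

namespace Summit.ResolutionOfSingularities.ResolutionOfSingularities.Theorems.WildQuotientResolution.JordanFive

variable (k : Type) [Field k] (n : ℕ) (b d : Fin n)
  (I : Ideal (MvPolynomial (Option (Fin n)) k)) (ι : MvPolynomial (Option (Fin n)) k)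
  (U : Type) [CommRing U] [Algebra (MvPolynomial (Option (Fin n)) k ⧸ I) U]
  [IsLocalization.Away (Ideal.Quotient.mk I ι) U] [Algebra k U]
  [IsScalarTower k (MvPolynomial (Option (Fin n)) k ⧸ I) U]
  (τU : U ≃ₐ[k] U)
  (τs : τU (algebraMap _ U (Ideal.Quotient.mk I (X none))) =
    -algebraMap _ U (Ideal.Quotient.mk I (X none)))
  (τb : τU (algebraMap _ U (Ideal.Quotient.mk I (X (some b)))) =
    -algebraMap _ U (Ideal.Quotient.mk I (X (some b))))
  (τd : τU (algebraMap _ U (Ideal.Quotient.mk I (X (some d)))) =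
    -algebraMap _ U (Ideal.Quotient.mk I (X (some d))))
  (τi : ∀ i, i ≠ b → i ≠ d → τU (algebraMap _ U (Ideal.Quotient.mk I (X (some i)))) =
    algebraMap _ U (Ideal.Quotient.mk I (X (some i))))
  (hιU : τU (algebraMap _ U (Ideal.Quotient.mk I ι)) = algebraMap _ U (Ideal.Quotient.mk I ι))

/-! ## The even generators are invariant -/

omit [IsScalarTower k (MvPolynomial (Option (Fin n)) k ⧸ I) U] in
include τs τb τd τi hιU in
/-- The even generators and `1/ι` are `τ_U`-invariant: `k[even, 1/ι] ≤ U^{⟨τ_U⟩}`. [OURS · L1 W4.5c] -/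
theorem adjoin_even_le_fixedPoints :
    Algebra.adjoin k ((fun x => algebraMap _ U (Ideal.Quotient.mk I x)) ''
        ({X none ^ 2, X none * X (some b), X none * X (some d), X (some b) ^ 2,
          X (some b) * X (some d), X (some d) ^ 2} ∪
          Set.range (fun i : {i : Fin n // i ≠ b ∧ i ≠ d} => X (some i.1))) ∪
        {IsLocalization.Away.invSelf (Ideal.Quotient.mk I ι)}) ≤
      FixedPoints.subalgebra k U (Subgroup.zpowers τU) := by
  refine Algebra.adjoin_le ?_
  rintro x (⟨g, hg, rfl⟩ | hx)
  · rw [SetLike.mem_coe, mem_fixedPoints_zpowers_iff_apply_eq]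
    rcases hg with hg | ⟨i, rfl⟩
    · simp only [Set.mem_insert_iff, Set.mem_singleton_iff] at hg
      rcases hg with rfl | rfl | rfl | rfl | rfl | rfl <;> dsimp only
      · rw [map_pow, map_pow, map_pow, τs, neg_sq]
      · rw [map_mul, map_mul, map_mul, τs, τb, neg_mul_neg]
      · rw [map_mul, map_mul, map_mul, τs, τd, neg_mul_neg]
      · rw [map_pow, map_pow, map_pow, τb, neg_sq]
      · rw [map_mul, map_mul, map_mul, τb, τd, neg_mul_neg]
      · rw [map_pow, map_pow, map_pow, τd, neg_sq]
    · exact τi i.1 i.2.1 i.2.2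
  · rw [Set.mem_singleton_iff] at hx
    rw [hx, SetLike.mem_coe, mem_fixedPoints_zpowers_iff_apply_eq]
    have e1 : algebraMap _ U (Ideal.Quotient.mk I ι) *
        IsLocalization.Away.invSelf (Ideal.Quotient.mk I ι) = 1 :=
      IsLocalization.Away.mul_invSelf _
    have e2 : algebraMap _ U (Ideal.Quotient.mk I ι) *
        τU (IsLocalization.Away.invSelf (Ideal.Quotient.mk I ι)) = 1 := by
      rw [← hιU, ← map_mul, e1, map_one]
    calc τU (IsLocalization.Away.invSelf (Ideal.Quotient.mk I ι))
        = τU (IsLocalization.Away.invSelf (Ideal.Quotient.mk I ι)) *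
            (algebraMap _ U (Ideal.Quotient.mk I ι) *
              IsLocalization.Away.invSelf (Ideal.Quotient.mk I ι)) := by rw [e1, mul_one]
      _ = algebraMap _ U (Ideal.Quotient.mk I ι) *
            τU (IsLocalization.Away.invSelf (Ideal.Quotient.mk I ι)) *
              IsLocalization.Away.invSelf (Ideal.Quotient.mk I ι) := by ring
      _ = IsLocalization.Away.invSelf (Ideal.Quotient.mk I ι) := by rw [e2, one_mul]

/-! ## The even decomposition `u = e₀ + e₁ s + e₂ Y₁ + e₃ Y₃` -/

/-- **Every element of `U` is `e₀ + e₁ s + e₂ Y₁ + e₃ Y₃` with `eᵢ ∈ k[even, 1/ι]`.** [OURS · L1 W4.5c] -/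
theorem exists_even_decomposition (u : U) :
    ∃ e₀ ∈ Algebra.adjoin k ((fun x => algebraMap _ U (Ideal.Quotient.mk I x)) ''
        ({X none ^ 2, X none * X (some b), X none * X (some d), X (some b) ^ 2,
          X (some b) * X (some d), X (some d) ^ 2} ∪
          Set.range (fun i : {i : Fin n // i ≠ b ∧ i ≠ d} => X (some i.1))) ∪
        {IsLocalization.Away.invSelf (Ideal.Quotient.mk I ι)}),
    ∃ e₁ ∈ Algebra.adjoin k ((fun x => algebraMap _ U (Ideal.Quotient.mk I x)) ''
        ({X none ^ 2, X none * X (some b), X none * X (some d), X (some b) ^ 2,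
          X (some b) * X (some d), X (some d) ^ 2} ∪
          Set.range (fun i : {i : Fin n // i ≠ b ∧ i ≠ d} => X (some i.1))) ∪
        {IsLocalization.Away.invSelf (Ideal.Quotient.mk I ι)}),
    ∃ e₂ ∈ Algebra.adjoin k ((fun x => algebraMap _ U (Ideal.Quotient.mk I x)) ''
        ({X none ^ 2, X none * X (some b), X none * X (some d), X (some b) ^ 2,
          X (some b) * X (some d), X (some d) ^ 2} ∪
          Set.range (fun i : {i : Fin n // i ≠ b ∧ i ≠ d} => X (some i.1))) ∪
        {IsLocalization.Away.invSelf (Ideal.Quotient.mk I ι)}),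
    ∃ e₃ ∈ Algebra.adjoin k ((fun x => algebraMap _ U (Ideal.Quotient.mk I x)) ''
        ({X none ^ 2, X none * X (some b), X none * X (some d), X (some b) ^ 2,
          X (some b) * X (some d), X (some d) ^ 2} ∪
          Set.range (fun i : {i : Fin n // i ≠ b ∧ i ≠ d} => X (some i.1))) ∪
        {IsLocalization.Away.invSelf (Ideal.Quotient.mk I ι)}),
      u = e₀ + e₁ * algebraMap _ U (Ideal.Quotient.mk I (X none)) +
        e₂ * algebraMap _ U (Ideal.Quotient.mk I (X (some b))) +
        e₃ * algebraMap _ U (Ideal.Quotient.mk I (X (some d))) := by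
  classical
  -- notation
  set E := Algebra.adjoin k ((fun x => algebraMap _ U (Ideal.Quotient.mk I x)) ''
        ({X none ^ 2, X none * X (some b), X none * X (some d), X (some b) ^ 2,
          X (some b) * X (some d), X (some d) ^ 2} ∪
          Set.range (fun i : {i : Fin n // i ≠ b ∧ i ≠ d} => X (some i.1))) ∪
        {IsLocalization.Away.invSelf (Ideal.Quotient.mk I ι)}) with hE
  set π : MvPolynomial (Option (Fin n)) k → U := fun x => algebraMap _ U (Ideal.Quotient.mk I x)
    with hπ
  have hπmul : ∀ x y, π (x * y) = π x * π y := fun x y => by simp only [hπ, map_mul]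
  have hπadd : ∀ x y, π (x + y) = π x + π y := fun x y => by simp only [hπ, map_add]
  -- generators in `E`
  have hgen : ∀ g ∈ ({X none ^ 2, X none * X (some b), X none * X (some d), X (some b) ^ 2,
      X (some b) * X (some d), X (some d) ^ 2} : Set (MvPolynomial (Option (Fin n)) k)), π g ∈ E :=
    fun g hg => Algebra.subset_adjoin (Or.inl ⟨g, Or.inl hg, rfl⟩)
  have hSS : π (X none) * π (X none) ∈ E := by
    rw [← hπmul, ← pow_two]; exact hgen _ (by simp)
  have hSB : π (X none) * π (X (some b)) ∈ E := by rw [← hπmul]; exact hgen _ (by simp)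
  have hSD : π (X none) * π (X (some d)) ∈ E := by rw [← hπmul]; exact hgen _ (by simp)
  have hBB : π (X (some b)) * π (X (some b)) ∈ E := by
    rw [← hπmul, ← pow_two]; exact hgen _ (by simp)
  have hBD : π (X (some b)) * π (X (some d)) ∈ E := by rw [← hπmul]; exact hgen _ (by simp)
  have hDD : π (X (some d)) * π (X (some d)) ∈ E := by
    rw [← hπmul, ← pow_two]; exact hgen _ (by simp)
  have hXi : ∀ i, i ≠ b → i ≠ d → π (X (some i)) ∈ E := fun i hib hid =>
    Algebra.subset_adjoin (Or.inl ⟨X (some i), Or.inr ⟨⟨i, hib, hid⟩, rfl⟩, rfl⟩)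
  have hinv : IsLocalization.Away.invSelf (Ideal.Quotient.mk I ι) ∈ E :=
    Algebra.subset_adjoin (Or.inr rfl)
  -- the predicate
  let P : U → Prop := fun u => ∃ e₀ ∈ E, ∃ e₁ ∈ E, ∃ e₂ ∈ E, ∃ e₃ ∈ E,
    u = e₀ + e₁ * π (X none) + e₂ * π (X (some b)) + e₃ * π (X (some d))
  have Padd : ∀ u v, P u → P v → P (u + v) := by
    rintro u v ⟨a₀, ha₀, a₁, ha₁, a₂, ha₂, a₃, ha₃, rfl⟩ ⟨c₀, hc₀, c₁, hc₁, c₂, hc₂, c₃, hc₃, rfl⟩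
    exact ⟨a₀ + c₀, add_mem ha₀ hc₀, a₁ + c₁, add_mem ha₁ hc₁, a₂ + c₂, add_mem ha₂ hc₂, a₃ + c₃,
      add_mem ha₃ hc₃, by ring⟩
  have Pmul : ∀ u w, w ∈ E → P u → P (u * w) := by
    rintro u w hw ⟨a₀, ha₀, a₁, ha₁, a₂, ha₂, a₃, ha₃, rfl⟩
    exact ⟨a₀ * w, mul_mem ha₀ hw, a₁ * w, mul_mem ha₁ hw, a₂ * w, mul_mem ha₂ hw, a₃ * w,
      mul_mem ha₃ hw, by ring⟩
  have PS : ∀ u, P u → P (u * π (X none)) := by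
    rintro u ⟨a₀, ha₀, a₁, ha₁, a₂, ha₂, a₃, ha₃, rfl⟩
    refine ⟨a₁ * (π (X none) * π (X none)) + a₂ * (π (X none) * π (X (some b))) +
      a₃ * (π (X none) * π (X (some d))), add_mem (add_mem (mul_mem ha₁ hSS) (mul_mem ha₂ hSB))
        (mul_mem ha₃ hSD), a₀, ha₀, 0, zero_mem _, 0, zero_mem _, by ring⟩
  have PB : ∀ u, P u → P (u * π (X (some b))) := by
    rintro u ⟨a₀, ha₀, a₁, ha₁, a₂, ha₂, a₃, ha₃, rfl⟩
    refine ⟨a₁ * (π (X none) * π (X (some b))) + a₂ * (π (X (some b)) * π (X (some b))) +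
      a₃ * (π (X (some b)) * π (X (some d))), add_mem (add_mem (mul_mem ha₁ hSB) (mul_mem ha₂ hBB))
        (mul_mem ha₃ hBD), 0, zero_mem _, a₀, ha₀, 0, zero_mem _, by ring⟩
  have PD : ∀ u, P u → P (u * π (X (some d))) := by
    rintro u ⟨a₀, ha₀, a₁, ha₁, a₂, ha₂, a₃, ha₃, rfl⟩
    refine ⟨a₁ * (π (X none) * π (X (some d))) + a₂ * (π (X (some b)) * π (X (some d))) +
      a₃ * (π (X (some d)) * π (X (some d))), add_mem (add_mem (mul_mem ha₁ hSD) (mul_mem ha₂ hBD))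
        (mul_mem ha₃ hDD), 0, zero_mem _, 0, zero_mem _, a₀, ha₀, by ring⟩
  -- polynomials
  have Ppoly : ∀ x : MvPolynomial (Option (Fin n)) k, P (π x) := by
    intro x
    induction x using MvPolynomial.induction_on with
    | C r =>
      refine ⟨π (C r), ?_, 0, zero_mem _, 0, zero_mem _, 0, zero_mem _, by ring⟩
      have : π (C r) = algebraMap k U r := algebraMap_mk_C k n I U r
      rw [this]
      exact Subalgebra.algebraMap_mem _ r
    | add p q hp hq => rw [hπadd]; exact Padd _ _ hp hq
    | mul_X p o hp =>
      rw [hπmul]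
      rcases o with _ | i
      · exact PS _ hp
      · by_cases hib : i = b
        · subst hib; exact PB _ hp
        by_cases hid : i = d
        · subst hid; exact PD _ hp
        exact Pmul _ _ (hXi i hib hid) hp
  -- general elements
  obtain ⟨⟨x, m⟩, hxm⟩ := IsLocalization.surj (Submonoid.powers (Ideal.Quotient.mk I ι)) u
  obtain ⟨j, hj⟩ := m.2
  obtain ⟨x, rfl⟩ := Ideal.Quotient.mk_surjective x
  have hinvj : algebraMap _ U (m : MvPolynomial (Option (Fin n)) k ⧸ I) *
      IsLocalization.Away.invSelf (Ideal.Quotient.mk I ι) ^ j = 1 := by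
    rw [← hj, map_pow, ← mul_pow, IsLocalization.Away.mul_invSelf, one_pow]
  have hu : u = π x * IsLocalization.Away.invSelf (Ideal.Quotient.mk I ι) ^ j := by
    calc u = u * (algebraMap _ U (m : MvPolynomial (Option (Fin n)) k ⧸ I) *
          IsLocalization.Away.invSelf (Ideal.Quotient.mk I ι) ^ j) := by rw [hinvj, mul_one]
      _ = u * algebraMap _ U (m : MvPolynomial (Option (Fin n)) k ⧸ I) *
          IsLocalization.Away.invSelf (Ideal.Quotient.mk I ι) ^ j := by rw [mul_assoc]
      _ = _ := by rw [hxm]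
  have hP : P u := by
    rw [hu]
    exact Pmul _ _ (pow_mem hinv j) (Ppoly x)
  exact hP

/-! ## The even subring is the ring of `τ`-invariants -/

include τs τb τd τi hιU in
/-- **`U^{⟨τ_U⟩} = k[s², sY₁, sY₃, Y₁², Y₁Y₃, Y₃², Y_i (i ∉ {b,d}), 1/ι]`** (`2 ≠ 0` in `k`).
[OURS · L1 W4.5c] -/
theorem fixedPoints_coverTau_eq_adjoin (h2 : (2 : k) ≠ 0) :
    FixedPoints.subalgebra k U (Subgroup.zpowers τU) =
      Algebra.adjoin k ((fun x => algebraMap _ U (Ideal.Quotient.mk I x)) ''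
        ({X none ^ 2, X none * X (some b), X none * X (some d), X (some b) ^ 2,
          X (some b) * X (some d), X (some d) ^ 2} ∪
          Set.range (fun i : {i : Fin n // i ≠ b ∧ i ≠ d} => X (some i.1))) ∪
        {IsLocalization.Away.invSelf (Ideal.Quotient.mk I ι)}) := by
  apply le_antisymm
  · intro u hu
    rw [mem_fixedPoints_zpowers_iff_apply_eq] at hu
    obtain ⟨e₀, he₀, e₁, he₁, e₂, he₂, e₃, he₃, hue⟩ := exists_even_decomposition k n b d I ι U u
    have hle := adjoin_even_le_fixedPoints k n b d I ι U τU τs τb τd τi hιU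
    have hf : ∀ e ∈ Algebra.adjoin k ((fun x => algebraMap _ U (Ideal.Quotient.mk I x)) ''
        ({X none ^ 2, X none * X (some b), X none * X (some d), X (some b) ^ 2,
          X (some b) * X (some d), X (some d) ^ 2} ∪
          Set.range (fun i : {i : Fin n // i ≠ b ∧ i ≠ d} => X (some i.1))) ∪
        {IsLocalization.Away.invSelf (Ideal.Quotient.mk I ι)}), τU e = e := fun e he =>
      (mem_fixedPoints_zpowers_iff_apply_eq τU e).mp (hle he)
    have hτu : τU u = e₀ - e₁ * algebraMap _ U (Ideal.Quotient.mk I (X none)) -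
        e₂ * algebraMap _ U (Ideal.Quotient.mk I (X (some b))) -
        e₃ * algebraMap _ U (Ideal.Quotient.mk I (X (some d))) := by
      rw [hue, map_add, map_add, map_add, map_mul, map_mul, map_mul, hf e₀ he₀, hf e₁ he₁, hf e₂ he₂,
        hf e₃ he₃, τs, τb, τd]
      ring
    have h2U : IsUnit (2 : U) := by
      have hu2 : IsUnit (algebraMap k U 2) := (isUnit_iff_ne_zero.mpr h2).map _
      rwa [map_ofNat] at hu2
    have hodd : e₁ * algebraMap _ U (Ideal.Quotient.mk I (X none)) +
        e₂ * algebraMap _ U (Ideal.Quotient.mk I (X (some b))) +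
        e₃ * algebraMap _ U (Ideal.Quotient.mk I (X (some d))) = 0 := by
      have e : (2 : U) * (e₁ * algebraMap _ U (Ideal.Quotient.mk I (X none)) +
          e₂ * algebraMap _ U (Ideal.Quotient.mk I (X (some b))) +
          e₃ * algebraMap _ U (Ideal.Quotient.mk I (X (some d)))) = 0 := by
        have := hu
        rw [hτu] at this
        linear_combination -hue - this
      exact (h2U.mul_right_eq_zero).mp e
    have : u = e₀ := by rw [hue]; linear_combination hodd
    rw [this]
    exact he₀
  · exact adjoin_even_le_fixedPoints k n b d I ι U τU τs τb τd τi hιU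

end Summit.ResolutionOfSingularities.ResolutionOfSingularities.Theorems.WildQuotientResolution.JordanFive

end
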